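import Mathlib
import Summits.MatrixMultiplication.MatrixMultiplication.Theorems.LevelGradedCohnUmansLevelOneGL2DesignsStubTangencySetsHermitianCirclesRigidity

/-!
# Stub `stub_tangencySets` (crux `LevelOneGL2Designs`, stmt-MatrixMultiplication-14080) —
wall-breaker axis 1/12 "Hermitian unital constructions", part 4: the residual of the unitary family
in the stub's quantifier shape

Parts 2–3 (`…HermitianCircles.lean`, `…HermitianCirclesRigidity.lean`) classified the affine tangency
sets of `AG(2,p)` invariant under the unitary group `U₁` of the norm form `x² − n y²`:
`|V| ≤ 2(p+1) + 1` if `−1` is a non-square, `|V| ≤ (p+1)·|I| + 1` with `I` a Paley coclique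
otherwise.  This file states the consequence for the stub in its own `∃ c > 0, ∀ p₀, ∃ p ≥ p₀`
shape:

* `paleyCocliques_of_unitaryInvariant_tangencySets`: if for some `c > 0` and unboundedly many primes
  `p` there are `U₁`-invariant affine tangency sets with `c·p^{3/2}` points, then for some `c' > 0`
  (`c' = c/4`) and unboundedly many primes there are Paley cocliques of size `c'·p^{1/2}` — verbatim
  the hypothesis of `ParabolaLift.tangencySets_of_large_cocliques` (axis 11) and, up to the exponent
  notation, of `TangencyRandAlg.tangencySets_of_paleyCocliques` (axis 12).

So the `U₁`-symmetric sub-case of `stub_tangencySets` is not merely sufficient-via but EQUIVALENT to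
the common Paley residual of the construction axes (the converse composition is the parabola or
circle pencil).  Elementary real-exponent bookkeeping; no new definitions.
-/

set_option linter.dupNamespace false

namespace Summit.MatrixMultiplication.MatrixMultiplication.Theorems.LevelOneGL2Designs.HermitianUnital

open Finset Matrix

/-- **Residual of the unitary family.**  `U₁`-invariant affine tangency sets of size `c·p^{3/2}`
for unboundedly many primes force Paley cocliques of size `(c/4)·p^{1/2}` for unboundedly many
primes (necessarily `p ≡ 1 (mod 4)`: for `−1` a non-square such sets have `≤ 2p + 3 < c·p^{3/2}`
points once `p > 25/c²`).  [elementary; from `card_unitaryInvariant_tangencySet_le`] -/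
theorem paleyCocliques_of_unitaryInvariant_tangencySets
    (h : ∃ c : ℝ, 0 < c ∧ ∀ p₀ : ℕ, ∃ (p : ℕ) (_ : Fact p.Prime), p₀ ≤ p ∧
      ∃ (n : ZMod p) (V : Finset (Fin 2 → ZMod p)), ¬ IsSquare n ∧
        (∀ v ∈ V, ∀ c s : ZMod p, c ^ 2 - n * s ^ 2 = 1 →
          ![c * v 0 + n * s * v 1, s * v 0 + c * v 1] ∈ V) ∧
        (∀ v ∈ V, ∃ u : Fin 2 → ZMod p, u ≠ 0 ∧ ∀ w ∈ V, u ⬝ᵥ w = u ⬝ᵥ v → w = v) ∧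
        c * (p : ℝ) ^ (3 / 2 : ℝ) ≤ V.card) :
    ∃ c : ℝ, 0 < c ∧ ∀ p₀ : ℕ, ∃ (p : ℕ) (_ : Fact p.Prime), p₀ ≤ p ∧
      ∃ S : Finset (ZMod p), c * (p : ℝ) ^ (1 / 2 : ℝ) ≤ S.card ∧
        ∀ s ∈ S, ∀ s' ∈ S, s ≠ s' → ¬ IsSquare (s - s') := by
  obtain ⟨c, hc, hV⟩ := h
  refine ⟨c / 4, by positivity, fun p₀ => ?_⟩
  -- ask for a prime beyond `p₀`, `25/c²` and `2/c`
  obtain ⟨p, hp, hp₀, n, V, hn, hinv, htan, hbig⟩ :=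
    hV (max p₀ (⌈25 / c ^ 2⌉₊ + ⌈2 / c⌉₊ + 1))
  refine ⟨p, hp, le_trans (le_max_left _ _) hp₀, ?_⟩
  have hpmax : ⌈25 / c ^ 2⌉₊ + ⌈2 / c⌉₊ + 1 ≤ p := le_trans (le_max_right _ _) hp₀
  have h25 : 25 / c ^ 2 < p := by
    have h1 : (25 / c ^ 2 : ℝ) ≤ ⌈25 / c ^ 2⌉₊ := Nat.le_ceil _
    have h2 : ((⌈25 / c ^ 2⌉₊ : ℕ) : ℝ) + 1 ≤ p := by
      exact_mod_cast (show ⌈25 / c ^ 2⌉₊ + 1 ≤ p by omega)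
    linarith
  have h2c : 2 / c ≤ p := by
    have h1 : (2 / c : ℝ) ≤ ⌈2 / c⌉₊ := Nat.le_ceil _
    have h2 : ((⌈2 / c⌉₊ : ℕ) : ℝ) ≤ p := by exact_mod_cast (show ⌈2 / c⌉₊ ≤ p by omega)
    linarith
  have hp0 : (0 : ℝ) < p := by exact_mod_cast hp.out.pos
  have hp1 : (1 : ℝ) ≤ p := by exact_mod_cast hp.out.one_lt.le
  -- `x = p^{1/2}`, `x² = p`, `p^{3/2} = p·x`
  set x : ℝ := (p : ℝ) ^ (1 / 2 : ℝ) with hx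
  have hx0 : 0 < x := Real.rpow_pos_of_pos hp0 _
  have hx2 : x ^ 2 = p := by
    rw [hx, ← Real.rpow_natCast, ← Real.rpow_mul hp0.le]
    norm_num
  have h32 : (p : ℝ) ^ (3 / 2 : ℝ) = p * x := by
    rw [hx, show (3 / 2 : ℝ) = 1 + 1 / 2 by norm_num, Real.rpow_add hp0, Real.rpow_one]
  rw [h32] at hbig
  -- `c·x > 5`, `x ≥ 1`, `(c/2)·p·x ≥ 1`
  have hc2p : 25 < c ^ 2 * p := by
    rw [div_lt_iff₀ (by positivity)] at h25
    linarith
  have hcx : 5 < c * x := by nlinarith [hx2, mul_pos hc hx0, hc2p]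
  have hx1 : 1 ≤ x := by nlinarith [hx2, hx0, hp1]
  have hcp : 2 ≤ c * p := by
    rw [div_le_iff₀ hc] at h2c
    linarith
  have hone : 1 ≤ c / 2 * p * x := by nlinarith [hcp, hx1, hc]
  -- the classification of part 3
  have hcl := card_unitaryInvariant_tangencySet_le hn V hinv htan
  by_cases hm1 : IsSquare (-1 : ZMod p)
  · obtain ⟨I, hcoc, hle⟩ := hcl.2 hm1
    refine ⟨I, ?_, hcoc⟩
    by_contra hlt
    rw [not_le] at hlt
    have hle' : (V.card : ℝ) ≤ (p + 1) * I.card + 1 := by exact_mod_cast hle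
    have hp2 : (p + 1 : ℝ) ≤ 2 * p := by linarith
    have hI0 : (0 : ℝ) ≤ I.card := by positivity
    have hlt' : (p + 1 : ℝ) * I.card + 1 < c * (p * x) := by nlinarith [hlt, hone, hp2, hx0, hc, hI0]
    linarith
  · exfalso
    have hle' : (V.card : ℝ) ≤ 2 * (p + 1) + 1 := by exact_mod_cast hcl.1 hm1
    have h5 : (2 * (p + 1) + 1 : ℝ) ≤ 5 * p := by linarith
    have hlt : (5 : ℝ) * p < c * (p * x) := by nlinarith [hcx, hp0]
    linarith

end Summit.MatrixMultiplication.MatrixMultiplication.Theorems.LevelOneGL2Designs.HermitianUnital
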